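import Summits.CriticalPhenomena.PercolationContinuityZ3.Theorems.PercNearOneGluingNoHeavyLowerTailSahiMixtureFourRefutation
import Literature.Combinatorics.Sahi2008.UnderlyingIndependents
import Literature.Combinatorics.Sahi2008.KahnQuestionOne
import HarnessLib

/-!
# The FRESH-COIN LEMMA (abstract form, hypothesis `hFCL` of `…SahiHittingFreshCoin`) FAILS on a finite product space

Support file of the Sahi / hitting-event programme (seat `prim-l12-p5`, gen 16; `--supports stmt-CriticalPhenomena-4575`).
No definitions, no named facts, no sorries; standard axioms.  Memo `run/shared/lean/prim/prim-l12/FROM-prim-l12-p5-g16-FCL-REFUTED-ON-CUBES.md`.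

CONTEXT.  `…SahiHittingFreshCoin.sahiE_hit_nonneg_of_freshCoin` (this seat, gen 14) reduces Sahi positivity of every hitting family
at every order (Q-OR) to the hypothesis `hFCL` ("OR-ing one fresh independent coin onto any sub-family of a family of events that is
Sahi-nonnegative at every order keeps it so"), stated for the product weight `bernoulliWeight p` on a cube `Set ι` and quantified over
ALL families of events of that cube.  The law-level form of the same assertion is the OR half of `SahiMixture.MixtureBernsteinPositivity`
(seat prim-masterthm P3), refuted in the kernel by ttrl cp-mix's four-event law (`…SahiMixtureFourRefutation`: `cex4Weight` on `Fin 8`,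
events `cex4Event`, all orders by the eleven square-free rows, and `E_4(A_0 ∪ H, A_1 ∪ H, A_2, A_3) = −10301/6860000` for a fair coin `H`).

THIS FILE transports that counterexample INTO A CUBE, so that the hypothesis `hFCL` itself — verbatim, with its quantifier structure — is
false on some finite product space:
* `isFKGMeasure_of_linearOrder`: every probability weight on a finite CHAIN satisfies the FKG lattice condition (with equality);
* `exists_coinRepresentation_of_weight`: hence (Kahn's footnote, tree theorem `IsFKGMeasure.exists_coinRepresentation`, applied on the
  chain `Fin |α|`) EVERY probability weight on a finite type is the push-forward of a non-degenerate coin weight `coinWeight q`,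
  `q ∈ (0,1)^m`, along some map `G : (Fin m → Bool) → α` (no monotonicity claimed or needed);
* `exists_cube_freshCoin_counterexample`: on the cube `Set (Fin m)` with `bernoulliWeight p` (`p = q` read in `[0,1]`), the pulled-back
  events `E_i = Ψ⁻¹(A_i × Bool)` and the pulled-back coin `C = Ψ⁻¹(Fin 8 × {true})` (`Ψ = G ∘ setCube`) satisfy: `1_C` is uncorrelated with
  every block product `∏_{i∈S} 1_{E_i}`, `(E_i)` is Sahi-nonnegative at every order with multiplicities, and yet
  `E_4(1_{E_0 ∪ C}, 1_{E_1 ∪ C}, 1_{E_2}, 1_{E_3}) = −10301/6860000 < 0` (`sahiE_pushWeight`: Sahi's functional only sees the law);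
* **`exists_cube_not_freshCoinLemma`**: ∃ `m`, `p : Fin m → unitInterval` such that the hypothesis `hFCL` of
  `sahiE_hit_nonneg_of_freshCoin` (at `ι = Fin m`) is FALSE.
So the gen-14 reduction cannot be fed: any proof of Q-OR must use the realisability of the family (hitting events of a product measure),
not merely its all-orders positivity — in agreement with the census (ttrl COIN.md §9) and with P3's hierarchy (HIERARCHY.md §12–13).
HONEST FRAMING: a refutation of an ABSTRACT lemma; nothing is claimed about hitting events, for which no violation is known. [this work]
-/

noncomputable section

namespace Summit.CriticalPhenomena.PercolationContinuityZ3.Theorems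

namespace SahiHittingFreshCoin

open Finset Function Literature.Combinatorics.Sahi2008
open Literature.Combinatorics.Sahi2008.Kahn2022 (setCube bernoulliWeight_eq_coinWeight_setCube)
open Literature.Probability.Percolation.DecisionTree (ind ind_of_mem ind_of_not_mem ind_nonneg)

/-! ### Plumbing -/

/-- Pulling an indicator back along a map gives the indicator of the preimage. [folklore] -/
theorem ind_comp_eq_ind_preimage {β γ : Type*} (X : Set γ) (G : β → γ) : ind X ∘ G = ind (G ⁻¹' X) := by
  funext b
  by_cases h : G b ∈ X
  · rw [comp_apply, ind_of_mem h, ind_of_mem (Set.mem_preimage.2 h)]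
  · rw [comp_apply, ind_of_not_mem h, ind_of_not_mem fun h' => h (Set.mem_preimage.1 h')]

/-- **Every probability weight on a finite chain is an FKG weight**: on a linear order `{a ⊓ b, a ⊔ b} = {a, b}`, so the lattice
condition holds with equality. [folklore] -/
theorem isFKGMeasure_of_linearOrder {α : Type*} [LinearOrder α] [Fintype α] {μ : α → ℝ}
    (hμ : ∀ a, 0 ≤ μ a) (hμ1 : ∑ a, μ a = 1) : IsFKGMeasure μ where
  nonneg := hμ
  sum_eq_one := hμ1
  mul_le_mul a b := by
    rcases le_total a b with h | h
    · rw [inf_eq_left.2 h, sup_eq_right.2 h]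
    · rw [inf_eq_right.2 h, sup_eq_left.2 h, mul_comm]

/-- **Every probability weight on a finite type is the law of a function of finitely many independent non-degenerate coins**:
`μ = G_* (coinWeight q)`, `q ∈ (0,1)^m`.  (Transport `μ` to the chain `Fin |α|`, which is a distributive lattice on which `μ` is FKG by
`isFKGMeasure_of_linearOrder`, apply the tree's coin representation of FKG weights, and transport back.) [cite: Kahn2022, p. 2 footnote 1] -/
theorem exists_coinRepresentation_of_weight {α : Type*} [Fintype α] {μ : α → ℝ}
    (hμ : ∀ a, 0 ≤ μ a) (hμ1 : ∑ a, μ a = 1) :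
    ∃ (m : ℕ) (q : Fin m → ℝ) (G : (Fin m → Bool) → α),
      (∀ i, 0 < q i ∧ q i < 1) ∧ μ = pushWeight (coinWeight q) G := by
  classical
  let e : α ≃ Fin (Fintype.card α) := Fintype.equivFin α
  have hν : IsFKGMeasure (pushWeight μ e) := by
    refine isFKGMeasure_of_linearOrder (fun c => pushWeight_nonneg hμ e c) ?_
    rw [sum_pushWeight, hμ1]
  obtain ⟨m, q, G, hq, -, hrep⟩ := hν.exists_coinRepresentation
  refine ⟨m, q, e.symm ∘ G, hq, ?_⟩
  calc μ = pushWeight μ id := (pushWeight_id μ).symm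
    _ = pushWeight μ (e.symm ∘ e) := by rw [Equiv.symm_comp_self]
    _ = pushWeight (pushWeight μ e) e.symm := (pushWeight_pushWeight μ e e.symm).symm
    _ = pushWeight (coinWeight q) (e.symm ∘ G) := by rw [hrep, pushWeight_pushWeight]

/-- The product weight of a cube pushed along its Boolean coordinates `setCube` is the coin weight. [cite: Kahn2022, p. 2 footnote 1 (b)] -/
theorem pushWeight_bernoulliWeight_setCube {m : ℕ} (q : Fin m → ℝ) (hq : ∀ i, 0 ≤ q i ∧ q i ≤ 1) :
    pushWeight (bernoulliWeight (fun i => (⟨q i, (hq i).1, (hq i).2⟩ : unitInterval))) (setCube m) = coinWeight q := by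
  funext y
  rw [pushWeight_equiv, bernoulliWeight_eq_coinWeight_setCube q hq, Equiv.apply_symm_apply]

/-- Marginal of P3's coin space: pushing `μ ⊗ coin(h)` along the first projection returns `μ`. [folklore] -/
theorem pushWeight_coinWeight_fst {α : Type*} [Fintype α] (μ : α → ℝ) (h : ℝ) :
    pushWeight (SahiMixture.coinWeight μ h) Prod.fst = μ := by
  classical
  funext a
  rw [pushWeight_eq_ex, SahiMixture.ex_coinWeight]
  have e : ∀ b : Bool, ex μ (fun a' : α => if (a', b).1 = a then (1 : ℝ) else 0) = μ a := by
    intro b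
    rw [ex_def]
    simp only [mul_ite, mul_one, mul_zero]
    rw [Finset.sum_ite_eq' Finset.univ a, if_pos (Finset.mem_univ a)]
  simp only [e]
  ring

/-- The coin event `{ξ}` of P3's coin space. [folklore] -/
theorem ind_coinEvent_apply {α : Type*} (a : α) (b : Bool) :
    ind {x : α × Bool | x.2 = true} (a, b) = (bif b then 1 else 0) := by
  cases b
  · exact ind_of_not_mem (by simp)
  · exact ind_of_mem (by simp)

/-- Off/on the coin, the member event `A × Bool` (= `orCoin A false`) has indicator `1_A`. [folklore] -/
theorem ind_orCoin_false_apply {α : Type*} (A : Set α) (a : α) (b : Bool) :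
    ind (SahiMixture.orCoin A false) (a, b) = ind A a := by
  cases b
  · exact SahiMixture.ind_orCoin_false A false a
  · rw [SahiMixture.ind_orCoin_true]; rfl

/-- The member event composed with the first projection. [folklore] -/
theorem ind_orCoin_false_eq_comp {α : Type*} (A : Set α) :
    ind (SahiMixture.orCoin A false) = ind A ∘ Prod.fst := by
  funext x
  obtain ⟨a, b⟩ := x
  exact ind_orCoin_false_apply A a b

/-- OR-ing the coin: `(A × Bool) ∪ {ξ} = orCoin A true`. [folklore] -/
theorem orCoin_false_union_coinEvent {α : Type*} (A : Set α) :
    SahiMixture.orCoin A false ∪ {x : α × Bool | x.2 = true} = SahiMixture.orCoin A true := by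
  ext x
  simp [SahiMixture.orCoin]

/-! ### The counterexample on a cube -/

/-- **A cube on which the fresh-coin step destroys all-orders positivity.**  There are `m`, biases `p ∈ (0,1)^m`, four events `E_i` of the
cube `Set (Fin m)` and an event `C` such that, under `bernoulliWeight p`: `1_C` is uncorrelated with every block product of the `1_{E_i}`,
the family `(E_i)` is Sahi-nonnegative at every order with multiplicities, and `E_4(1_{E_0∪C}, 1_{E_1∪C}, 1_{E_2}, 1_{E_3}) = −10301/6860000`.
(The cube realises cp-mix's law `cex4Weight ⊗ coin(½)`; the events are the pulled-back members and coin.) [this work; counterexample: ttrl cp-mix] -/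
theorem exists_cube_freshCoin_counterexample :
    ∃ (m : ℕ) (p : Fin m → unitInterval) (E : Fin 4 → Set (Set (Fin m))) (C : Set (Set (Fin m))),
      (∀ i, 0 < (p i : ℝ) ∧ (p i : ℝ) < 1) ∧
      (∀ S : Finset (Fin 4),
        ex (bernoulliWeight p) (ind C * ∏ i ∈ S, ind (E i)) =
          ex (bernoulliWeight p) (ind C) * ex (bernoulliWeight p) (∏ i ∈ S, ind (E i))) ∧
      (∀ (m' : ℕ) (κ : Fin m' → Fin 4), 0 ≤ sahiE (bernoulliWeight p) m' (fun j => ind (E (κ j)))) ∧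
      sahiE (bernoulliWeight p) 4 ![ind (E 0 ∪ C), ind (E 1 ∪ C), ind (E 2), ind (E 3)] = -10301/6860000 := by
  classical
  -- the law `cex4Weight ⊗ coin(1/2)` on `Fin 8 × Bool` is the image of a cube
  set W : Fin 8 × Bool → ℝ := SahiMixture.coinWeight SahiMixture.cex4Weight (1/2 : ℝ) with hWdef
  have hW0 : ∀ x, 0 ≤ W x := fun x =>
    SahiMixture.coinWeight_nonneg SahiMixture.cex4Weight_nonneg (by norm_num) (by norm_num) x
  have hW1 : ∑ x, W x = 1 := SahiMixture.sum_coinWeight SahiMixture.sum_cex4Weight _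
  obtain ⟨m, q, G, hq, hrep⟩ := exists_coinRepresentation_of_weight hW0 hW1
  have hq' : ∀ i, 0 ≤ q i ∧ q i ≤ 1 := fun i => ⟨(hq i).1.le, (hq i).2.le⟩
  let p : Fin m → unitInterval := fun i => ⟨q i, (hq' i).1, (hq' i).2⟩
  let Ψ : Set (Fin m) → Fin 8 × Bool := G ∘ setCube m
  have hΨ : pushWeight (bernoulliWeight p) Ψ = W := by
    rw [← pushWeight_pushWeight, pushWeight_bernoulliWeight_setCube q hq', ← hrep]
  -- transfer of expectations and of Sahi's functionals along `Ψ`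
  have hex : ∀ g : Fin 8 × Bool → ℝ, ex (bernoulliWeight p) (g ∘ Ψ) = ex W g := fun g => by
    rw [← ex_pushWeight, hΨ]
  have hsahi : ∀ (n : ℕ) (f : Fin n → Fin 8 × Bool → ℝ),
      sahiE (bernoulliWeight p) n (fun i => f i ∘ Ψ) = sahiE W n f := fun n f => by
    rw [← sahiE_pushWeight, hΨ]
  -- the events
  let M : Fin 4 → Set (Fin 8 × Bool) := fun i => SahiMixture.orCoin (SahiMixture.cex4Event i) false
  set Cev : Set (Fin 8 × Bool) := {x | x.2 = true} with hCev
  refine ⟨m, p, fun i => Ψ ⁻¹' M i, Ψ ⁻¹' Cev, hq, ?_, ?_, ?_⟩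
  · -- independence of the coin from the block products
    intro S
    have hprod : (∏ i ∈ S, ind (Ψ ⁻¹' M i)) = (∏ i ∈ S, ind (M i)) ∘ Ψ := by
      funext ω
      simp only [Finset.prod_apply, comp_apply, ← ind_comp_eq_ind_preimage]
    have hC : ind (Ψ ⁻¹' Cev) = ind Cev ∘ Ψ := (ind_comp_eq_ind_preimage Cev Ψ).symm
    have hmul : ind Cev ∘ Ψ * (∏ i ∈ S, ind (M i)) ∘ Ψ = (ind Cev * ∏ i ∈ S, ind (M i)) ∘ Ψ := rfl
    rw [hprod, hC, hmul, hex, hex, hex, hWdef, SahiMixture.ex_coinWeight, SahiMixture.ex_coinWeight,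
      SahiMixture.ex_coinWeight]
    have hP : ∀ (a : Fin 8) (b : Bool), (∏ i ∈ S, ind (M i)) (a, b) = ∏ i ∈ S, ind (SahiMixture.cex4Event i) a := by
      intro a b
      rw [Finset.prod_apply]
      exact Finset.prod_congr rfl fun i _ => ind_orCoin_false_apply _ a b
    simp only [Pi.mul_apply, hP, hCev, ind_coinEvent_apply, cond_true, cond_false, zero_mul, one_mul]
    rw [ex_const SahiMixture.sum_cex4Weight 0, ex_const SahiMixture.sum_cex4Weight 1]
    ring
  · -- all-orders positivity of the pulled-back members = that of cp-mix's four events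
    intro m' κ
    have hfam : (fun j => ind (Ψ ⁻¹' M (κ j))) = fun j => ind (M (κ j)) ∘ Ψ := by
      funext j; rw [ind_comp_eq_ind_preimage]
    rw [hfam, hsahi]
    have hfam' : (fun j => ind (M (κ j))) = fun j => ind (SahiMixture.cex4Event (κ j)) ∘ Prod.fst := by
      funext j; exact ind_orCoin_false_eq_comp _
    rw [hfam', ← sahiE_pushWeight, hWdef, pushWeight_coinWeight_fst]
    exact SahiMixture.allOrders_cex4 m' κ
  · -- the pushed family has `E_4 < 0`
    have hfam : (![ind (Ψ ⁻¹' M 0 ∪ Ψ ⁻¹' Cev), ind (Ψ ⁻¹' M 1 ∪ Ψ ⁻¹' Cev), ind (Ψ ⁻¹' M 2), ind (Ψ ⁻¹' M 3)] :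
        Fin 4 → Set (Fin m) → ℝ) =
        fun j => (![ind (SahiMixture.orCoin (SahiMixture.cex4Event 0) true), ind (SahiMixture.orCoin (SahiMixture.cex4Event 1) true),
          ind (SahiMixture.orCoin (SahiMixture.cex4Event 2) false), ind (SahiMixture.orCoin (SahiMixture.cex4Event 3) false)] :
            Fin 4 → Fin 8 × Bool → ℝ) j ∘ Ψ := by
      funext j
      fin_cases j
      · show ind (Ψ ⁻¹' M 0 ∪ Ψ ⁻¹' Cev) = ind (SahiMixture.orCoin (SahiMixture.cex4Event 0) true) ∘ Ψ
        rw [← Set.preimage_union, ind_comp_eq_ind_preimage, orCoin_false_union_coinEvent]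
      · show ind (Ψ ⁻¹' M 1 ∪ Ψ ⁻¹' Cev) = ind (SahiMixture.orCoin (SahiMixture.cex4Event 1) true) ∘ Ψ
        rw [← Set.preimage_union, ind_comp_eq_ind_preimage, orCoin_false_union_coinEvent]
      · show ind (Ψ ⁻¹' M 2) = ind (SahiMixture.orCoin (SahiMixture.cex4Event 2) false) ∘ Ψ
        rw [ind_comp_eq_ind_preimage]
      · show ind (Ψ ⁻¹' M 3) = ind (SahiMixture.orCoin (SahiMixture.cex4Event 3) false) ∘ Ψ
        rw [ind_comp_eq_ind_preimage]
    rw [hfam, hsahi, hWdef]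
    exact SahiMixture.sahiE_four_orCoin_cex4

/-- **THE FRESH-COIN LEMMA IS FALSE ON SOME CUBE.**  There are `m` and biases `p : Fin m → unitInterval` (all in `(0,1)`) such that the
hypothesis `hFCL` of `SahiHittingFreshCoin.sahiE_hit_nonneg_of_freshCoin` at `ι = Fin m` — "for every family of events `E` of the cube,
every event `C` uncorrelated with the block products of `E`, and every set of slots `T`: if `E` is Sahi-nonnegative at every order with
multiplicities then so is `(E_i ∪ C [i ∈ T], E_i [i ∉ T])`" — FAILS (with `n = 4`, `T = {0,1}`, at order `4`). [this work; counterexample: ttrl cp-mix] -/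
theorem exists_cube_not_freshCoinLemma :
    ∃ (m : ℕ) (p : Fin m → unitInterval), (∀ i, 0 < (p i : ℝ) ∧ (p i : ℝ) < 1) ∧
      ¬ (∀ (n : ℕ) (E : Fin n → Set (Set (Fin m))) (C : Set (Set (Fin m))) (T : Finset (Fin n)),
          (∀ S : Finset (Fin n),
            ex (bernoulliWeight p) (ind C * ∏ i ∈ S, ind (E i)) =
              ex (bernoulliWeight p) (ind C) * ex (bernoulliWeight p) (∏ i ∈ S, ind (E i))) →
          (∀ (m' : ℕ) (κ : Fin m' → Fin n), 0 ≤ sahiE (bernoulliWeight p) m' (fun j => ind (E (κ j)))) →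
          ∀ (m' : ℕ) (κ : Fin m' → Fin n),
            0 ≤ sahiE (bernoulliWeight p) m' (fun j => ind (E (κ j) ∪ (if κ j ∈ T then C else ∅)))) := by
  obtain ⟨m, p, E, C, hp, hind, hgood, hval⟩ := exists_cube_freshCoin_counterexample
  refine ⟨m, p, hp, fun hFCL => ?_⟩
  have h := hFCL 4 E C {0, 1} hind hgood 4 id
  have hfam : (fun j : Fin 4 => ind (E (id j) ∪ (if id j ∈ ({0, 1} : Finset (Fin 4)) then C else ∅))) =
      ![ind (E 0 ∪ C), ind (E 1 ∪ C), ind (E 2), ind (E 3)] := by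
    funext j
    fin_cases j <;> simp
  rw [hfam, hval] at h
  norm_num at h

end SahiHittingFreshCoin

end Summit.CriticalPhenomena.PercolationContinuityZ3.Theorems

end
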